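import Mathlib
import Summits.PneNP.PneNP.Theorems.OverlapGapAlgebraSearchHardWindowTwoRoundLocalRung
import Summits.PneNP.PneNP.Theorems.OverlapGapAlgebraSearchHardWindowRadiusLocal

/-!
# PneNP / OverlapGapAlgebra — `SearchHardWindow` / `SolvableImpliesStableSection`:
# RADIUS-`r` LOCAL RULES are ℓ²-stable (2/2) — the rung with a rate, the transfer, the crux form

Support for cruxes `stmt-PneNP-2460` and `stmt-PneNP-2463`. Consequences of `…RadiusLocal`
(radius-`r` local rules are ℓ²-stable at scale `s₂(n) = (2k(3k log n + k + 1)^r)² + 1`) for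
every CONSTANT radius `r`:

* `shwRad_isLittleO` — the scale is admissible: `s₂(n) log³ n = O(log^{2r+3} n) = o(n)`;
* `shwRad_localMapsFail_rate` — UNCONDITIONALLY (via `noStableSection_proof` inside
  `shwMSR_successCount_le_rate`): for `k ≥ k₀` and every `r`, every radius-`r` local search map
  solves at most a `C_{k,r} log^{2r+2} n / n` fraction of `F_k(n, ⌊α_k n⌋)`,
  `α_k = 5·2^k log k / k` — the in-tree form, with a polynomial rate and for the LABELLED class,
  of "local algorithms fail in the Bresler–Huang window";
* `shwRad_stableSection_of_solvable` — the conclusion of `SolvableImpliesStableSection` at every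
  `(k ≥ 1, α, η, ν)` whenever some radius-`r` local map solves an `ε`-fraction infinitely often
  (`sissMS_concl_of_meanSquareStableSolver`);
* `shwRad_hardnessConjunct_window` — the hardness conjunct of `SearchHardWindow`, verbatim, for
  ANY `f : List Bool → List Bool` whose decoded assignment is eventually a radius-`r` local rule,
  at `(k, α_k)` for all `k ≥ k₀` and every `r`.
No definitions; axioms `propext`, `Classical.choice`, `Quot.sound`.
-/

set_option linter.dupNamespace false -- `Summit.PneNP.PneNP.…`: summit = sub-problem (D-0017)

namespace Summit.PneNP.PneNP.Theorems

open Finset Filter Asymptotics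
open scoped Classical

section RadiusRung

variable {m k n : ℕ}

/-- The sensitivity scale of radius-`r` local rules is admissible:
`((2k(3k log n + k + 1)^r)² + 1) · log³ n = O(log^{2r+3} n) = o(n)`. -/
theorem shwRad_isLittleO (k r : ℕ) :
    (fun n : ℕ => ((2 * k * (3 * k * Real.log n + k + 1) ^ r) ^ 2 + 1) * Real.log n ^ 3)
      =o[atTop] (fun n : ℕ => (n : ℝ)) := by
  have h1 : (fun n : ℕ => Real.log n ^ (2 * r + 3)) =o[atTop] (fun n : ℕ => (n : ℝ)) := by
    have := (Real.isLittleO_pow_log_id_atTop (n := 2 * r + 3)).comp_tendsto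
      tendsto_natCast_atTop_atTop
    simpa [Function.comp_def] using this
  have hk0 : (0 : ℝ) ≤ k := Nat.cast_nonneg _
  set K : ℝ := (2 * k * (4 * k + 1) ^ r) ^ 2 + 1 with hK
  have h2 : (fun n : ℕ => ((2 * k * (3 * k * Real.log n + k + 1) ^ r) ^ 2 + 1) * Real.log n ^ 3)
      =O[atTop] (fun n : ℕ => Real.log n ^ (2 * r + 3)) := by
    refine IsBigO.of_bound K ?_
    filter_upwards [eventually_ge_atTop 3] with n hn
    have hn3 : (3 : ℝ) ≤ n := by exact_mod_cast hn
    have hL1 : 1 ≤ Real.log n := by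
      rw [← Real.log_exp 1]
      apply Real.log_le_log (Real.exp_pos 1)
      have : Real.exp 1 ≤ 3 := le_of_lt (lt_trans Real.exp_one_lt_d9 (by norm_num))
      exact this.trans hn3
    have hL0 : 0 ≤ Real.log n := by linarith only [hL1]
    set L := Real.log n with hL
    have hbase0 : 0 ≤ 3 * k * L + k + 1 := by positivity
    have hbase : 3 * k * L + k + 1 ≤ (4 * k + 1) * L := by nlinarith only [hL1, hk0]
    have hpow : (3 * k * L + k + 1) ^ r ≤ (4 * k + 1) ^ r * L ^ r := by
      rw [← mul_pow]
      exact pow_le_pow_left₀ hbase0 hbase r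
    have hs0 : 0 ≤ 2 * k * (3 * k * L + k + 1) ^ r := by positivity
    have hs : 2 * k * (3 * k * L + k + 1) ^ r ≤ (2 * k * (4 * k + 1) ^ r) * L ^ r := by
      have := mul_le_mul_of_nonneg_left hpow (by positivity : (0 : ℝ) ≤ 2 * k)
      linarith only [this]
    have hsq : (2 * k * (3 * k * L + k + 1) ^ r) ^ 2 ≤ ((2 * k * (4 * k + 1) ^ r) * L ^ r) ^ 2 :=
      pow_le_pow_left₀ hs0 hs 2
    have hL2r : 1 ≤ (L ^ r) ^ 2 := one_le_pow₀ (one_le_pow₀ hL1)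
    have hval : ((2 * k * (3 * k * L + k + 1) ^ r) ^ 2 + 1) * L ^ 3 ≤ K * L ^ (2 * r + 3) := by
      have h3 : 0 ≤ L ^ 3 := by positivity
      calc ((2 * k * (3 * k * L + k + 1) ^ r) ^ 2 + 1) * L ^ 3
          ≤ (((2 * k * (4 * k + 1) ^ r) * L ^ r) ^ 2 + (L ^ r) ^ 2) * L ^ 3 := by
            apply mul_le_mul_of_nonneg_right _ h3
            linarith only [hsq, hL2r]
        _ = K * L ^ (2 * r + 3) := by rw [hK]; ring
    have hlhs0 : 0 ≤ ((2 * k * (3 * k * L + k + 1) ^ r) ^ 2 + 1) * L ^ 3 := by positivity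
    rw [Real.norm_eq_abs, Real.norm_eq_abs, abs_of_nonneg hlhs0, abs_of_nonneg (by positivity)]
    exact hval
  exact h2.trans_isLittleO h1

/-- **Radius-`r` local rules fail in the Bresler–Huang window, with a polynomial rate
(unconditional, every constant radius).** For all `k ≥ k₀` and every `r` there is `C > 0` such that,
eventually in `n`, every radius-`r` local search map on `F_k(n, ⌊α_k n⌋)`, `α_k = 5·2^k log k/k`,
solves at most a `C log^{2r+2} n / n` fraction of the instances. -/
theorem shwRad_localMapsFail_rate :
    ∃ k₀ : ℕ, ∀ k : ℕ, k₀ ≤ k → ∀ r : ℕ, ∃ C : ℝ, 0 < C ∧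
      ∀ᶠ n : ℕ in atTop, ∀ m : ℕ, m = ⌊5 * 2 ^ k * Real.log k / k * n⌋₊ →
        ∀ g : (Fin m → Fin k → Fin n × Bool) → (Fin n → Bool),
          (∀ (Φ Φ' : Fin m → Fin k → Fin n × Bool) (v : Fin n),
            (∀ i : Fin m,
              ((∃ j : Fin k, ∃ p : ℕ → Fin n, p 0 = v ∧ p r = (Φ i j).1 ∧ ∀ s, s < r → (p s = p (s + 1) ∨
            ∃ i' : Fin m, ∃ j₁ j₂ : Fin k, (Φ i' j₁).1 = p s ∧ (Φ i' j₂).1 = p (s + 1))) ∨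
               (∃ j : Fin k, ∃ p : ℕ → Fin n, p 0 = v ∧ p r = (Φ' i j).1 ∧ ∀ s, s < r → (p s = p (s + 1) ∨
            ∃ i' : Fin m, ∃ j₁ j₂ : Fin k, (Φ' i' j₁).1 = p s ∧ (Φ' i' j₂).1 = p (s + 1)))) →
              Φ i = Φ' i) →
            g Φ v = g Φ' v) →
          ((Finset.univ.filter fun Φ : Fin m → Fin k → Fin n × Bool =>
              ∀ i, ∃ j, g Φ (Φ i j).1 = (Φ i j).2).card : ℝ)
            ≤ C * Real.log n ^ (2 * r + 2) / n * Fintype.card (Fin m → Fin k → Fin n × Bool) := by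
  obtain ⟨k₀, h⟩ := shwMSR_successCount_le_rate
  refine ⟨k₀, fun k hk r => ?_⟩
  obtain ⟨C₀, hC₀, hmain⟩ := h k hk
  have hk0 : (0 : ℝ) ≤ k := Nat.cast_nonneg _
  set K : ℝ := (2 * k * (4 * k + 1) ^ r) ^ 2 + 2 with hK
  have hKpos : 0 < K := by rw [hK]; positivity
  refine ⟨C₀ * K, mul_pos hC₀ hKpos, ?_⟩
  set α : ℝ := 5 * 2 ^ k * Real.log k / k with hαdef
  have hα : 0 ≤ α := by
    rw [hαdef]
    exact div_nonneg (mul_nonneg (by positivity) (Real.log_natCast_nonneg k)) (Nat.cast_nonneg k)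
  have hev := hmain (fun n : ℕ => (2 * k * (3 * k * Real.log n + k + 1) ^ r) ^ 2 + 1)
    (shwRad_isLittleO k r)
  have hlargeE : ∀ᶠ n : ℕ in atTop, Real.exp (α * k * Real.exp 2) ≤ (n : ℝ) ^ 3 :=
    ((tendsto_pow_atTop (by norm_num : (3 : ℕ) ≠ 0)).comp tendsto_natCast_atTop_atTop).eventually_ge_atTop _
  filter_upwards [hev, hlargeE, eventually_ge_atTop 3] with n hn hlarge hn3 m hm g hloc
  have hn1 : 1 ≤ n := le_trans (by norm_num) hn3
  have hn3R : (3 : ℝ) ≤ n := by exact_mod_cast hn3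
  have hnpos : (0 : ℝ) < n := by linarith only [hn3R]
  have hm_le : (m : ℝ) ≤ α * n := by rw [hm]; exact Nat.floor_le (by positivity)
  have hS := shwRad_meanSquare (r := r) hn1 α hα hm_le hlarge g hloc
  have hs0 : (0 : ℝ) ≤ (2 * k * (3 * k * Real.log n + k + 1) ^ r) ^ 2 + 1 := by positivity
  have hle := hn m hm g hs0 hS
  have hL1 : 1 ≤ Real.log n := by
    rw [← Real.log_exp 1]
    apply Real.log_le_log (Real.exp_pos 1)
    have : Real.exp 1 ≤ 3 := le_of_lt (lt_trans Real.exp_one_lt_d9 (by norm_num))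
    exact this.trans hn3R
  set L := Real.log n with hL
  have hL0 : 0 ≤ L := by linarith only [hL1]
  have hbase0 : 0 ≤ 3 * k * L + k + 1 := by positivity
  have hbase : 3 * k * L + k + 1 ≤ (4 * k + 1) * L := by nlinarith only [hL1, hk0]
  have hpow : (3 * k * L + k + 1) ^ r ≤ (4 * k + 1) ^ r * L ^ r := by
    rw [← mul_pow]
    exact pow_le_pow_left₀ hbase0 hbase r
  have hs0' : 0 ≤ 2 * k * (3 * k * L + k + 1) ^ r := by positivity
  have hs : 2 * k * (3 * k * L + k + 1) ^ r ≤ (2 * k * (4 * k + 1) ^ r) * L ^ r := by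
    have := mul_le_mul_of_nonneg_left hpow (by positivity : (0 : ℝ) ≤ 2 * k)
    linarith only [this]
  have hsq : (2 * k * (3 * k * L + k + 1) ^ r) ^ 2 ≤ ((2 * k * (4 * k + 1) ^ r) * L ^ r) ^ 2 :=
    pow_le_pow_left₀ hs0' hs 2
  have hL2r : 1 ≤ (L ^ r) ^ 2 := one_le_pow₀ (one_le_pow₀ hL1)
  have hLbig : 1 ≤ L ^ (2 * r + 2) := one_le_pow₀ hL1
  have hpoly : 1 + L ^ 2 * ((2 * k * (3 * k * L + k + 1) ^ r) ^ 2 + 1) ≤ K * L ^ (2 * r + 2) := by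
    have hL2nn : 0 ≤ L ^ 2 := by positivity
    have h1 : L ^ 2 * ((2 * k * (3 * k * L + k + 1) ^ r) ^ 2 + 1)
        ≤ L ^ 2 * (((2 * k * (4 * k + 1) ^ r) * L ^ r) ^ 2 + (L ^ r) ^ 2) := by
      apply mul_le_mul_of_nonneg_left _ hL2nn
      linarith only [hsq, hL2r]
    have h2 : L ^ 2 * (((2 * k * (4 * k + 1) ^ r) * L ^ r) ^ 2 + (L ^ r) ^ 2) =
        ((2 * k * (4 * k + 1) ^ r) ^ 2 + 1) * L ^ (2 * r + 2) := by ring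
    rw [hK]
    linarith only [h1, h2, hLbig]
  have hNnn : (0 : ℝ) ≤ Fintype.card (Fin m → Fin k → Fin n × Bool) := Nat.cast_nonneg _
  calc ((Finset.univ.filter fun Φ : Fin m → Fin k → Fin n × Bool =>
        ∀ i, ∃ j, g Φ (Φ i j).1 = (Φ i j).2).card : ℝ)
      ≤ C₀ * (1 + L ^ 2 * ((2 * k * (3 * k * L + k + 1) ^ r) ^ 2 + 1)) / n
          * Fintype.card (Fin m → Fin k → Fin n × Bool) := hle
    _ ≤ C₀ * (K * L ^ (2 * r + 2)) / n * Fintype.card (Fin m → Fin k → Fin n × Bool) := by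
        apply mul_le_mul_of_nonneg_right _ hNnn
        apply div_le_div_of_nonneg_right _ hnpos.le
        exact mul_le_mul_of_nonneg_left hpoly hC₀.le
    _ = C₀ * K * L ^ (2 * r + 2) / n * Fintype.card (Fin m → Fin k → Fin n × Bool) := by ring

/-- **Radius-`r` local solvers give stable sections (the transfer, instantiated).** For every
`k ≥ 1`, `r`, `α, η, ν, ε > 0`: if, for infinitely many `n` (`m = ⌊αn⌋₊`), some radius-`r` local
search map solves at least an `ε`-fraction of `F_k(n, m)`, then for every `c > 0`, infinitely
often, some map is `νm`-valid at every splice point of the Bresler–Huang path and `ηn`-stable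
between consecutive ones on at least `e^{-cn}·#paths` of the path tuples — the conclusion of
`SolvableImpliesStableSection` at `(k, α, η, ν)`. -/
theorem shwRad_stableSection_of_solvable (k r : ℕ) (hk : 1 ≤ k) (α η ν : ℝ) (hα : 0 < α)
    (hη : 0 < η) (hν : 0 < ν) (ε : ℝ) (hε : 0 < ε)
    (hsolv : ∃ᶠ n : ℕ in atTop, ∀ m : ℕ, m = ⌊α * n⌋₊ →
      ∃ g : (Fin m → Fin k → Fin n × Bool) → (Fin n → Bool),
        (∀ (Φ Φ' : Fin m → Fin k → Fin n × Bool) (v : Fin n),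
          (∀ i : Fin m,
            ((∃ j : Fin k, ∃ p : ℕ → Fin n, p 0 = v ∧ p r = (Φ i j).1 ∧ ∀ s, s < r → (p s = p (s + 1) ∨
            ∃ i' : Fin m, ∃ j₁ j₂ : Fin k, (Φ i' j₁).1 = p s ∧ (Φ i' j₂).1 = p (s + 1))) ∨
             (∃ j : Fin k, ∃ p : ℕ → Fin n, p 0 = v ∧ p r = (Φ' i j).1 ∧ ∀ s, s < r → (p s = p (s + 1) ∨
            ∃ i' : Fin m, ∃ j₁ j₂ : Fin k, (Φ' i' j₁).1 = p s ∧ (Φ' i' j₂).1 = p (s + 1)))) →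
            Φ i = Φ' i) →
          g Φ v = g Φ' v) ∧
        ε * Fintype.card (Fin m → Fin k → Fin n × Bool) ≤
          ((Finset.univ.filter fun Φ : Fin m → Fin k → Fin n × Bool =>
            ∀ i, ∃ j, g Φ (Φ i j).1 = (Φ i j).2).card : ℝ))
    (c : ℝ) (hc : 0 < c) :
    ∃ᶠ n : ℕ in atTop, ∀ m : ℕ, m = ⌊α * n⌋₊ →
      ∃ g : (Fin m → Fin k → Fin n × Bool) → (Fin n → Bool),
        Real.exp (-(c * n)) * Fintype.card (Fin (k + 1) → Fin m → Fin k → Fin n × Bool) ≤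
        ((Finset.univ.filter fun Ψ : Fin (k + 1) → Fin m → Fin k → Fin n × Bool =>
          let P : Fin k → ℕ → Fin m → Fin k → Fin n × Bool :=
            fun r q a b => if (a : ℕ) * k + b < q then Ψ r.succ a b else Ψ r.castSucc a b
          (∀ r : Fin k, ∀ q ≤ m * k, ((Finset.univ.filter fun i : Fin m =>
            ∀ j, g (P r q) (P r q i j).1 ≠ (P r q i j).2).card : ℝ) ≤ ν * m) ∧
          ∀ r : Fin k, ∀ q < m * k,
            (hammingDist (g (P r q)) (g (P r (q + 1))) : ℝ) ≤ η * n).card : ℝ) := by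
  refine sissMS_concl_of_meanSquareStableSolver k hk α η ν hα hη hν
    (fun n : ℕ => (2 * k * (3 * k * Real.log n + k + 1) ^ r) ^ 2 + 1) (shwRad_isLittleO k r)
    ε hε ?_ c hc
  have hlargeE : ∀ᶠ n : ℕ in atTop, Real.exp (α * k * Real.exp 2) ≤ (n : ℝ) ^ 3 :=
    ((tendsto_pow_atTop (by norm_num : (3 : ℕ) ≠ 0)).comp tendsto_natCast_atTop_atTop).eventually_ge_atTop _
  refine (hsolv.and_eventually (hlargeE.and (eventually_ge_atTop 1))).mono ?_
  rintro n ⟨hn, hlarge, hn1⟩ m hm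
  obtain ⟨g, hloc, hsucc⟩ := hn m hm
  have hm_le : (m : ℝ) ≤ α * n := by rw [hm]; exact Nat.floor_le (by positivity)
  exact ⟨g, shwRad_meanSquare (r := r) hn1 α hα.le hm_le hlarge g hloc, hsucc⟩

end RadiusRung

section RadiusWindow

/-- **The radius-`r` local rung for the crux's hardness conjunct (verbatim shape, in the window).**
For all `k ≥ k₀`, every radius `r` and ANY `f : List Bool → List Bool` (no complexity hypothesis)
whose decoded assignment on `F_k(n, ⌊α_k n⌋)` is, eventually in `n`, a radius-`r` local rule
(`r` rounds of Belief/Survey/Warning Propagation followed by any local rounding, parallel local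
repair for `r` rounds, …), the hardness conjunct of `SearchHardWindow` holds for `f` at `(k, α_k)`. -/
theorem shwRad_hardnessConjunct_window :
    ∃ k₀ : ℕ, ∀ k : ℕ, k₀ ≤ k → ∀ (r : ℕ) (f : List Bool → List Bool),
      (∀ᶠ n : ℕ in atTop, ∀ m : ℕ, m = ⌊5 * 2 ^ k * Real.log k / k * n⌋₊ →
        ∀ (Φ Φ' : Fin m → Fin k → Fin n × Bool) (v : Fin n),
          (∀ i : Fin m,
            ((∃ j : Fin k, ∃ p : ℕ → Fin n, p 0 = v ∧ p r = (Φ i j).1 ∧ ∀ s, s < r → (p s = p (s + 1) ∨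
            ∃ i' : Fin m, ∃ j₁ j₂ : Fin k, (Φ i' j₁).1 = p s ∧ (Φ i' j₂).1 = p (s + 1))) ∨
             (∃ j : Fin k, ∃ p : ℕ → Fin n, p 0 = v ∧ p r = (Φ' i j).1 ∧ ∀ s, s < r → (p s = p (s + 1) ∨
            ∃ i' : Fin m, ∃ j₁ j₂ : Fin k, (Φ' i' j₁).1 = p s ∧ (Φ' i' j₂).1 = p (s + 1)))) →
            Φ i = Φ' i) →
          (f (Literature.Computability.Complexity.encodingCNF.encode (List.ofFn fun a =>
            List.ofFn fun b => (((Φ a b).1 : ℕ), (Φ a b).2)))).getD v false =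
          (f (Literature.Computability.Complexity.encodingCNF.encode (List.ofFn fun a =>
            List.ofFn fun b => (((Φ' a b).1 : ℕ), (Φ' a b).2)))).getD v false) →
      ∀ ε : ℝ, 0 < ε → ∀ᶠ n : ℕ in Filter.atTop, ∀ m : ℕ, m = ⌊5 * 2 ^ k * Real.log k / k * n⌋₊ →
        ((Finset.univ.filter fun Φ : Fin m → Fin k → Fin n × Bool => ∀ i, ∃ j,
            (f (Literature.Computability.Complexity.encodingCNF.encode (List.ofFn fun a =>
              List.ofFn fun b => (((Φ a b).1 : ℕ), (Φ a b).2)))).getD (Φ i j).1 false =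
                (Φ i j).2).card : ℝ) / Fintype.card (Fin m → Fin k → Fin n × Bool) ≤ ε := by
  obtain ⟨k₀, h⟩ := shwRad_localMapsFail_rate
  refine ⟨k₀, fun k hk r f hf ε hε => ?_⟩
  obtain ⟨C, hC, hrate⟩ := h k hk r
  have hlog : (fun n : ℕ => Real.log n ^ (2 * r + 2)) =o[atTop] (fun n : ℕ => (n : ℝ)) := by
    have := (Real.isLittleO_pow_log_id_atTop (n := 2 * r + 2)).comp_tendsto
      tendsto_natCast_atTop_atTop
    simpa [Function.comp_def] using this
  have hsmall := hlog.def (div_pos hε hC)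
  filter_upwards [hrate, hf, hsmall, eventually_ge_atTop 1] with n hn hfn hsm hn1
  intro m hm
  have hpos : (0 : ℝ) < Fintype.card (Fin m → Fin k → Fin n × Bool) := by
    have : 0 < n := hn1
    have : Nonempty (Fin n) := ⟨⟨0, this⟩⟩
    exact_mod_cast Fintype.card_pos
  have hnpos : (0 : ℝ) < n := by exact_mod_cast hn1
  have key := hn m hm (fun Φ v => (f (Literature.Computability.Complexity.encodingCNF.encode (List.ofFn fun a =>
            List.ofFn fun b => (((Φ a b).1 : ℕ), (Φ a b).2)))).getD v false) (hfn m hm)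
  rw [div_le_iff₀ hpos]
  refine key.trans (mul_le_mul_of_nonneg_right ?_ hpos.le)
  rw [Real.norm_eq_abs, Real.norm_eq_abs, abs_of_nonneg (by positivity),
    abs_of_nonneg hnpos.le] at hsm
  rw [div_le_iff₀ hnpos]
  calc C * Real.log n ^ (2 * r + 2) ≤ C * (ε / C * n) := mul_le_mul_of_nonneg_left hsm hC.le
    _ = ε * n := by field_simp

end RadiusWindow

section RadiusGrowing

/-- **Growing radius.** The same for radii `r(n) → ∞` as long as the sensitivity scale stays
admissible, `((2k(3k log n + k + 1)^{r(n)})² + 1) log³ n = o(n)` (e.g. `r(n) ≤ c log n / log log n`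
for a small `c = c(k) > 0`): for `k ≥ k₀`, radius-`r(n)` local search maps solve at most an
`ε`-fraction of `F_k(n, ⌊α_k n⌋)`, eventually, uniformly in the map. -/
theorem shwRad_localMapsFail_growing :
    ∃ k₀ : ℕ, ∀ k : ℕ, k₀ ≤ k → ∀ r : ℕ → ℕ,
      (fun n : ℕ => ((2 * k * (3 * k * Real.log n + k + 1) ^ (r n)) ^ 2 + 1) * Real.log n ^ 3)
        =o[atTop] (fun n : ℕ => (n : ℝ)) →
      ∀ ε : ℝ, 0 < ε → ∀ᶠ n : ℕ in atTop, ∀ m : ℕ, m = ⌊5 * 2 ^ k * Real.log k / k * n⌋₊ →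
        ∀ g : (Fin m → Fin k → Fin n × Bool) → (Fin n → Bool),
          (∀ (Φ Φ' : Fin m → Fin k → Fin n × Bool) (v : Fin n),
            (∀ i : Fin m,
              ((∃ j : Fin k, ∃ p : ℕ → Fin n, p 0 = v ∧ p (r n) = (Φ i j).1 ∧ ∀ s, s < r n → (p s = p (s + 1) ∨
            ∃ i' : Fin m, ∃ j₁ j₂ : Fin k, (Φ i' j₁).1 = p s ∧ (Φ i' j₂).1 = p (s + 1))) ∨
               (∃ j : Fin k, ∃ p : ℕ → Fin n, p 0 = v ∧ p (r n) = (Φ' i j).1 ∧ ∀ s, s < r n → (p s = p (s + 1) ∨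
            ∃ i' : Fin m, ∃ j₁ j₂ : Fin k, (Φ' i' j₁).1 = p s ∧ (Φ' i' j₂).1 = p (s + 1)))) →
              Φ i = Φ' i) →
            g Φ v = g Φ' v) →
          ((Finset.univ.filter fun Φ : Fin m → Fin k → Fin n × Bool =>
              ∀ i, ∃ j, g Φ (Φ i j).1 = (Φ i j).2).card : ℝ)
            ≤ ε * Fintype.card (Fin m → Fin k → Fin n × Bool) := by
  obtain ⟨k₀, h⟩ := shwMSR_successCount_le_rate
  refine ⟨k₀, fun k hk r hr ε hε => ?_⟩
  obtain ⟨C₀, hC₀, hmain⟩ := h k hk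
  set α : ℝ := 5 * 2 ^ k * Real.log k / k with hαdef
  have hα : 0 ≤ α := by
    rw [hαdef]
    exact div_nonneg (mul_nonneg (by positivity) (Real.log_natCast_nonneg k)) (Nat.cast_nonneg k)
  have hev := hmain _ hr
  have hlargeE : ∀ᶠ n : ℕ in atTop, Real.exp (α * k * Real.exp 2) ≤ (n : ℝ) ^ 3 :=
    ((tendsto_pow_atTop (by norm_num : (3 : ℕ) ≠ 0)).comp tendsto_natCast_atTop_atTop).eventually_ge_atTop _
  have hsmall := hr.def (div_pos hε (mul_pos two_pos hC₀))
  have hinv : ∀ᶠ n : ℕ in atTop, C₀ / n ≤ ε / 2 := by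
    have ht : Tendsto (fun n : ℕ => C₀ / (n : ℝ)) atTop (nhds 0) :=
      tendsto_const_nhds.div_atTop tendsto_natCast_atTop_atTop
    exact ht.eventually (ge_mem_nhds (half_pos hε))
  filter_upwards [hev, hlargeE, hsmall, hinv, eventually_ge_atTop 3] with n hn hlarge hsm hCn hn3
    m hm g hloc
  have hn1 : 1 ≤ n := le_trans (by norm_num) hn3
  have hn3R : (3 : ℝ) ≤ n := by exact_mod_cast hn3
  have hnpos : (0 : ℝ) < n := by linarith only [hn3R]
  have hm_le : (m : ℝ) ≤ α * n := by rw [hm]; exact Nat.floor_le (by positivity)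
  have hS := shwRad_meanSquare (r := r n) hn1 α hα hm_le hlarge g hloc
  have hs0 : (0 : ℝ) ≤ (2 * k * (3 * k * Real.log n + k + 1) ^ (r n)) ^ 2 + 1 := by positivity
  have hle := hn m hm g hs0 hS
  have hL1 : 1 ≤ Real.log n := by
    rw [← Real.log_exp 1]
    apply Real.log_le_log (Real.exp_pos 1)
    have : Real.exp 1 ≤ 3 := le_of_lt (lt_trans Real.exp_one_lt_d9 (by norm_num))
    exact this.trans hn3R
  set L := Real.log n with hL
  set S := (2 * k * (3 * k * L + k + 1) ^ (r n)) ^ 2 + 1 with hSdef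
  have hL0 : 0 < L := by linarith only [hL1]
  -- from `S L³ ≤ (ε / (2 C₀)) n`: `L² S ≤ (ε/(2C₀)) n`
  rw [Real.norm_eq_abs, Real.norm_eq_abs, abs_of_nonneg (by positivity), abs_of_nonneg hnpos.le] at hsm
  have hL2S : L ^ 2 * S ≤ ε / (2 * C₀) * n := by
    have h1 : L ^ 2 * S ≤ L ^ 3 * S := by
      have : L ^ 2 ≤ L ^ 3 := by nlinarith [hL1, pow_pos hL0 2]
      exact mul_le_mul_of_nonneg_right this (by positivity)
    have h2 : L ^ 3 * S = S * L ^ 3 := by ring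
    linarith only [h1, h2, hsm]
  have hNnn : (0 : ℝ) ≤ Fintype.card (Fin m → Fin k → Fin n × Bool) := Nat.cast_nonneg _
  have hcoef : C₀ * (1 + L ^ 2 * S) / n ≤ ε := by
    rw [div_le_iff₀ hnpos]
    have h1 : C₀ * (L ^ 2 * S) ≤ C₀ * (ε / (2 * C₀) * n) := mul_le_mul_of_nonneg_left hL2S hC₀.le
    have h2 : C₀ * (ε / (2 * C₀) * n) = ε / 2 * n := by field_simp
    have h3 : C₀ ≤ ε / 2 * n := by rwa [div_le_iff₀ hnpos] at hCn
    nlinarith only [h1, h2, h3]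
  calc ((Finset.univ.filter fun Φ : Fin m → Fin k → Fin n × Bool =>
        ∀ i, ∃ j, g Φ (Φ i j).1 = (Φ i j).2).card : ℝ)
      ≤ C₀ * (1 + L ^ 2 * S) / n * Fintype.card (Fin m → Fin k → Fin n × Bool) := hle
    _ ≤ ε * Fintype.card (Fin m → Fin k → Fin n × Bool) :=
        mul_le_mul_of_nonneg_right hcoef hNnn

end RadiusGrowing

end Summit.PneNP.PneNP.Theorems
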